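import Summits.Ventures.PercRepro.ProfilePointedCircuitClassesStarNineDefectA

/-!
# PercRepro — THE DEFECT FORM OF (★)₉ ON THE SIMPLE COSIMPLE CORE, PART B: EVERY `e`-DEFECT HAS A `C`-PAIR
(p5, gen 57; `proofs/P5-GM1.md` §85 ADD 2)

`cpair_of_defect`: on a simple cosimple matroid `N` with `#E = 9` and `e ≠ f`, every triple `τ ⊆ E − e − f` with
`τ + e` bi-independent and `τ + f` not contains a pair `π` with `π + e + f` bi-independent.  The case analysis of part A
on the three points of `τ` relative to the hyperplane `cl(E − e − f − τ)`: type 2 (`ρ(τ + f) = 4`, hence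
`e ∈ cl K`) — at most one point of `τ` lies in `cl K` (else `E − f − z ⊆ cl K` and `{f, z}` would be a series pair),
and the two-candidate lemma picks `z`; type 1 (`f ∈ cl τ`) — not all of `τ` lies in `cl K` (else `f ∈ cl K`), one
candidate outside forces the other two to span a line avoiding `f`, two candidates are handled by the two-candidate
lemma.
-/

open scoped Matroid

namespace PercRepro.Cogirth

open Finset ThmH Skew Shadow Profile

open Classical

variable {α : Type} [DecidableEq α] {N : Matroid α} [N.Finite]

section StarNineDefectB

/-- **EVERY `e`-DEFECT HAS A `C`-PAIR**: on a simple cosimple matroid with `#E = 9`, `ρ(E) = 5`, for `e ≠ f` and a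
triple `τ ⊆ E − e − f` with `τ + e` bi-independent and `τ + f` not, some pair `π ⊆ τ` has `π + e + f` bi-independent. -/
theorem cpair_of_defect (hn : (gr N).card = 9) (hsimple : ∀ x ∈ gr N, ∀ y ∈ gr N, x ≠ y → rk N {x, y} = 2)
    (hcos : ∀ x ∈ gr N, ∀ y ∈ gr N, x ≠ y → rk N (((gr N).erase x).erase y) = 5) {e f : α} (he : e ∈ gr N)
    (hf : f ∈ gr N) (hef : e ≠ f) {τ : Finset α} (hτX : τ ⊆ ((gr N).erase e).erase f) (hτ3 : τ.card = 3)
    (hτe : insert e τ ∈ biIndepSets N 4) (hτf : insert f τ ∉ biIndepSets N 4) :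
    ∃ π ⊆ τ, π.card = 2 ∧ insert e (insert f π) ∈ biIndepSets N 4 := by
  have hXg : ((gr N).erase e).erase f ⊆ gr N := (erase_subset _ _).trans (erase_subset _ _)
  have hτg : τ ⊆ gr N := hτX.trans hXg
  have heτ : e ∉ τ := fun h => (mem_erase.1 (mem_erase.1 (hτX h)).2).1 rfl
  have hfτ : f ∉ τ := fun h => (mem_erase.1 (hτX h)).1 rfl
  obtain ⟨hτeg, hτecard, hτerk, hcompl⟩ := mem_biIndepSets.1 hτe
  -- `K := X − τ`: independent of rank `4`, `f ∉ cl K`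
  set K := (((gr N).erase e).erase f) \ τ with hK
  have hKg : K ⊆ gr N := sdiff_subset.trans hXg
  have hcard_X : (((gr N).erase e).erase f).card = 7 := by
    rw [card_erase_of_mem (mem_erase.2 ⟨hef.symm, hf⟩), card_erase_of_mem he, hn]
  have hKcard : K.card = 4 := by
    rw [hK, card_sdiff_of_subset hτX, hcard_X, hτ3]
  have hcompl_eq : gr N \ insert e τ = insert f K := by
    ext a
    simp only [hK, mem_sdiff, mem_insert, mem_erase, not_or]
    constructor
    · rintro ⟨hag, hae, haτ⟩
      by_cases haf : a = f
      · exact Or.inl haf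
      · exact Or.inr ⟨⟨haf, hae, hag⟩, haτ⟩
    · rintro (rfl | ⟨⟨haf, hae, hag⟩, haτ⟩)
      · exact ⟨hf, hef.symm, hfτ⟩
      · exact ⟨hag, hae, haτ⟩
  rw [hcompl_eq] at hcompl
  have hfK' : f ∉ K := fun h => (mem_erase.1 (mem_sdiff.1 h).1).1 rfl
  have hKrk : rk N K = 4 := by
    have := rk_eq_card_of_subset_of_rk_eq_card (subset_insert f K) hcompl
    rw [hKcard] at this; exact this
  have hcardfK : (insert f K).card = 5 := by rw [card_insert_of_notMem hfK', hKcard]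
  rw [hcardfK] at hcompl
  have hfK : f ∉ clF N K := by
    rw [mem_clF_iff_rk_insert hf hKg, hcompl, hKrk]; omega
  have hτecard' : (insert e τ).card = 4 := by rw [card_insert_of_notMem heτ, hτ3]
  have hτerk4 : rk N (insert e τ) = 4 := by rw [hτerk, hτecard']
  have hτrk : rk N τ = 3 := by
    have := rk_eq_card_of_subset_of_rk_eq_card (subset_insert e τ) hτerk
    rw [hτ3] at this; exact this
  -- the two finishing moves
  have finish2 : ∀ z ∈ τ, z ∉ clF N K → f ∉ clF N (insert e (τ.erase z)) →
      ∃ π ⊆ τ, π.card = 2 ∧ insert e (insert f π) ∈ biIndepSets N 4 := by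
    intro z hz hzK hfπ
    refine ⟨τ.erase z, erase_subset _ _, by rw [card_erase_of_mem hz, hτ3], ?_⟩
    have hπe : rk N (insert e (τ.erase z)) = 3 := by
      have hsub : insert e (τ.erase z) ⊆ insert e τ := insert_subset_insert _ (erase_subset _ _)
      have := rk_eq_card_of_subset_of_rk_eq_card hsub hτerk
      rw [card_insert_of_notMem (fun h => heτ (mem_of_mem_erase h)), card_erase_of_mem hz, hτ3] at this
      exact this
    exact cpair_of_witness hn he hf hef hτX hτ3 hτe hz hzK
      (rk_insert_insert_of_type_two he hf ((erase_subset _ _).trans hτg) hπe hfπ)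
  have finish1 : ∀ z ∈ τ, z ∉ clF N K → rk N (insert f τ) = 3 → f ∉ clF N (τ.erase z) →
      ∃ π ⊆ τ, π.card = 2 ∧ insert e (insert f π) ∈ biIndepSets N 4 := by
    intro z hz hzK hf3 hfπ
    refine ⟨τ.erase z, erase_subset _ _, by rw [card_erase_of_mem hz, hτ3], ?_⟩
    have hπrk : rk N (τ.erase z) = 2 := by
      have := rk_eq_card_of_subset_of_rk_eq_card (erase_subset z τ) (by rw [hτrk, hτ3])
      rw [card_erase_of_mem hz, hτ3] at this; exact this
    have hπf : rk N (insert f (τ.erase z)) = 3 := by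
      rw [rk_insert_of_notMem_clF' hf ((erase_subset _ _).trans hτg) hfπ, hπrk]
    have hτf' : rk N (insert f (insert z (τ.erase z))) = 3 := by rw [insert_erase hz, hf3]
    have hτe' : rk N (insert e (insert z (τ.erase z))) = 4 := by rw [insert_erase hz, hτerk4]
    exact cpair_of_witness hn he hf hef hτX hτ3 hτe hz hzK
      (rk_insert_insert_of_type_one he hf (hτg hz) ((erase_subset _ _).trans hτg) (notMem_erase z τ) hπf hτf'
        hτe')
  -- the three points of `τ`
  obtain ⟨a, b, c, hab, hac, hbc, rfl⟩ := card_eq_three.1 hτ3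
  have ha : a ∈ ({a, b, c} : Finset α) := mem_insert_self _ _
  have hb : b ∈ ({a, b, c} : Finset α) := mem_insert_of_mem (mem_insert_self _ _)
  have hc : c ∈ ({a, b, c} : Finset α) := mem_insert_of_mem (mem_insert_of_mem (mem_singleton_self _))
  have hag : a ∈ gr N := hτg ha
  have hbg : b ∈ gr N := hτg hb
  have hcg : c ∈ gr N := hτg hc
  have hea : e ≠ a := fun h => heτ (h ▸ ha)
  have heb : e ≠ b := fun h => heτ (h ▸ hb)
  have hec : e ≠ c := fun h => heτ (h ▸ hc)
  have hfa : f ≠ a := fun h => hfτ (h ▸ ha)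
  have hfb : f ≠ b := fun h => hfτ (h ▸ hb)
  have hfc : f ≠ c := fun h => hfτ (h ▸ hc)
  have e_a : ({a, b, c} : Finset α).erase a = {b, c} := triple_erase_left hab hac
  have e_b : ({a, b, c} : Finset α).erase b = {a, c} := triple_erase_mid hab hbc
  have e_c : ({a, b, c} : Finset α).erase c = {a, b} := triple_erase_right hac hbc
  have e_cab : ({c, a, b} : Finset α) = {a, b, c} := triple_rot_cab a b c
  have e_bac : ({b, a, c} : Finset α) = {a, b, c} := triple_swap_ba a b c
  by_cases h4 : rk N (insert f ({a, b, c} : Finset α)) = 4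
  · -- TYPE 2: `e ∈ cl K`
    have heK : e ∈ clF N K := by
      have hcompl2 : gr N \ insert f ({a, b, c} : Finset α) = insert e K := by
        ext x
        simp only [hK, mem_sdiff, mem_insert, mem_erase, mem_singleton, not_or]
        constructor
        · rintro ⟨hxg, hxf, hxτ⟩
          by_cases hxe : x = e
          · exact Or.inl hxe
          · exact Or.inr ⟨⟨hxf, hxe, hxg⟩, hxτ⟩
        · rintro (rfl | ⟨⟨hxf, hxe, hxg⟩, hxτ⟩)
          · exact ⟨he, hef, hea, heb, hec⟩
          · exact ⟨hxg, hxf, hxτ⟩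
      have heK' : e ∉ K := fun h => (mem_erase.1 (mem_erase.1 (mem_sdiff.1 h).1).2).1 rfl
      by_contra heK
      apply hτf
      rw [mem_biIndepSets]
      refine ⟨insert_subset hf hτg, by rw [card_insert_of_notMem hfτ, hτ3], by
        rw [h4, card_insert_of_notMem hfτ, hτ3], ?_⟩
      rw [hcompl2, rk_insert_of_notMem_clF' he hKg heK, hKrk, card_insert_of_notMem heK', hKcard]
    have hcount : ∀ p q z : α, z ∈ ({a, b, c} : Finset α) → ({a, b, c} : Finset α).erase z = {p, q} →
        p ∈ clF N K → q ∈ clF N K → False := by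
      intro p q z hz hzpq hpK hqK
      have hzg : z ∈ gr N := hτg hz
      have hzf : z ≠ f := fun h => hfτ (h ▸ hz)
      have hsub : ((gr N).erase f).erase z ⊆ clF N K := by
        intro x hx
        have hxz : x ≠ z := (mem_erase.1 hx).1
        have hxf : x ≠ f := (mem_erase.1 (mem_erase.1 hx).2).1
        have hxg : x ∈ gr N := (mem_erase.1 (mem_erase.1 hx).2).2
        by_cases hxe : x = e
        · rw [hxe]; exact heK
        by_cases hxτ : x ∈ ({a, b, c} : Finset α)
        · have hx' : x ∈ ({a, b, c} : Finset α).erase z := mem_erase.2 ⟨hxz, hxτ⟩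
          rw [hzpq, mem_insert, mem_singleton] at hx'
          rcases hx' with rfl | rfl
          · exact hpK
          · exact hqK
        · exact subset_clF hKg (mem_sdiff.2 ⟨mem_erase.2 ⟨hxf, mem_erase.2 ⟨hxe, hxg⟩⟩, hxτ⟩)
      have h1 := rk_le_rk_of_subset_clF (N := N) hsub
      rw [hcos f hf z hzg hzf.symm, hKrk] at h1
      omega
    by_cases haK : a ∈ clF N K <;> by_cases hbK : b ∈ clF N K <;> by_cases hcK : c ∈ clF N K
    · exact (hcount a b c hc e_c haK hbK).elim
    · exact (hcount a b c hc e_c haK hbK).elim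
    · exact (hcount a c b hb e_b haK hcK).elim
    · -- `a ∈ cl K`, `b, c ∉`: candidates `b, c` with `w = a`
      rcases type_two_two_candidates hsimple hKg he hf hag hbg hcg hea heb hec hab hac hbc hef hfK heK
        (Or.inl haK) hτerk4 with h | h
      · exact finish2 b hb hbK (by rw [e_b]; exact h)
      · exact finish2 c hc hcK (by rw [e_c]; exact h)
    · exact (hcount b c a ha e_a hbK hcK).elim
    · -- `b ∈ cl K`, `a, c ∉`: `w = b`
      rcases type_two_two_candidates hsimple hKg he hf hbg hag hcg heb hea hec hab.symm hbc hac hef hfK heK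
        (Or.inl hbK) (by rw [e_bac]; exact hτerk4) with h | h
      · exact finish2 a ha haK (by rw [e_a]; exact h)
      · exact finish2 c hc hcK (by rw [e_c, pair_comm]; exact h)
    · -- `c ∈ cl K`, `a, b ∉`: `w = c`
      rcases type_two_two_candidates hsimple hKg he hf hcg hag hbg hec hea heb hac.symm hbc.symm hab hef hfK heK
        (Or.inl hcK) (by rw [e_cab]; exact hτerk4) with h | h
      · exact finish2 a ha haK (by rw [e_a, pair_comm]; exact h)
      · exact finish2 b hb hbK (by rw [e_b, pair_comm]; exact h)
    · -- none in `cl K`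
      by_cases hfab : f ∈ clF N (insert e ({a, b} : Finset α))
      · rcases type_two_two_candidates hsimple hKg he hf hcg hag hbg hec hea heb hac.symm hbc.symm hab hef hfK
          heK (Or.inr hfab) (by rw [e_cab]; exact hτerk4) with h | h
        · exact finish2 a ha haK (by rw [e_a, pair_comm]; exact h)
        · exact finish2 b hb hbK (by rw [e_b, pair_comm]; exact h)
      · exact finish2 c hc hcK (by rw [e_c]; exact hfab)
  · -- TYPE 1: `f ∈ cl τ`
    have hf3 : rk N (insert f ({a, b, c} : Finset α)) = 3 := by
      have h1 := rk_insert_eq hf hτg (M := N)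
      split_ifs at h1 <;> omega
    have hfτ' : f ∈ clF N ({a, b, c} : Finset α) := by
      rw [mem_clF_iff_rk_insert hf hτg, hf3, hτrk]
    have hone : ∀ z p q : α, z ∈ ({a, b, c} : Finset α) → ({a, b, c} : Finset α).erase z = {p, q} →
        p ∈ clF N K → q ∈ clF N K → z ∉ clF N K →
        ∃ π ⊆ ({a, b, c} : Finset α), π.card = 2 ∧ insert e (insert f π) ∈ biIndepSets N 4 := by
      intro z p q hz hzpq hpK hqK hzK
      refine finish1 z hz hzK hf3 ?_
      rw [hzpq]
      intro hfpq
      exact hfK (mem_clF_of_mem_clF_pair' hKg hpK hqK hfpq)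
    by_cases haK : a ∈ clF N K <;> by_cases hbK : b ∈ clF N K <;> by_cases hcK : c ∈ clF N K
    · -- all three in `cl K`: `f ∈ cl τ ⊆ cl K`
      exact (hfK (mem_clF_of_subset_clF' hKg (by
        intro x hx
        simp only [mem_insert, mem_singleton] at hx
        rcases hx with rfl | rfl | rfl
        · exact haK
        · exact hbK
        · exact hcK) hfτ')).elim
    · exact hone c a b hc e_c haK hbK hcK
    · exact hone b a c hb e_b haK hcK hbK
    · -- `b, c ∉ cl K`: `w = a`
      rcases type_one_two_candidates hsimple hf hag hbg hcg hab hac hbc hfa hfb hfc hτrk with h | h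
      · exact finish1 b hb hbK hf3 (by rw [e_b]; exact h)
      · exact finish1 c hc hcK hf3 (by rw [e_c]; exact h)
    · exact hone a b c ha e_a hbK hcK haK
    · -- `a, c ∉ cl K`: `w = b`
      rcases type_one_two_candidates hsimple hf hbg hag hcg hab.symm hbc hac hfb hfa hfc
        (by rw [e_bac]; exact hτrk) with h | h
      · exact finish1 a ha haK hf3 (by rw [e_a]; exact h)
      · exact finish1 c hc hcK hf3 (by rw [e_c, pair_comm]; exact h)
    · -- `a, b ∉ cl K`: `w = c`
      rcases type_one_two_candidates hsimple hf hcg hag hbg hac.symm hbc.symm hab hfc hfa hfb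
        (by rw [e_cab]; exact hτrk) with h | h
      · exact finish1 a ha haK hf3 (by rw [e_a, pair_comm]; exact h)
      · exact finish1 b hb hbK hf3 (by rw [e_b, pair_comm]; exact h)
    · -- none in `cl K`: `w = c`
      rcases type_one_two_candidates hsimple hf hcg hag hbg hac.symm hbc.symm hab hfc hfa hfb
        (by rw [e_cab]; exact hτrk) with h | h
      · exact finish1 a ha haK hf3 (by rw [e_a, pair_comm]; exact h)
      · exact finish1 b hb hbK hf3 (by rw [e_b, pair_comm]; exact h)

end StarNineDefectB

end PercRepro.Cogirth
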